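import Summits.BirchSwinnertonDyer.BirchSwinnertonDyer.Theorems.ClassRecordThreeIMCDivAtThreeLambdaMatchingCut

/-!
# BC3 LINE skeleton (PROPOSED; registered form) — crux `IMCDivTwoLociAtThreeR` (item stmt-BirchSwinnertonDyer-20262,
# route ClassRecordThree, K2@3) and its KOLY twin `IMCDivTwoLociTamAtThreeR` (stmt-BirchSwinnertonDyer-20263):
# ROAD B12 «λ-MATCHING TRANSFER» (cell memo PROOF-BDP §37; kernel p505319)

Seat `bsd-stepL-bdp` (prover g17, 2026-08-27), drafted for the planner to register
(`ledger skeleton check … --crux stmt-BirchSwinnertonDyer-20262`). Registered form: named stubs `stub_*`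
(sorries ONLY there), stub statements by name (`Statement.stub_*` via `type_of%`), the composition
`IMCDivTwoLociAtThreeR_of` concluding the ROUTE DECL by name (sorry-free), `IMCDivTwoLociAtThreeR_proof`,
and the KOLY twin `IMCDivTwoLociTamAtThreeR_of` ∕ `_proof` (same stubs; item 20263 ⟸ item 20262).

THE LINE. H3ᴮ@3 = `Three.IMCDivAt₃B W` (Ch_Λ(X_ac 𝔭bar)·R₀⟦T⟧ ⊆ (L_𝔭), the EISENSTEIN-side inclusion) on
Surj ∖ (ram ∧ non-split@3) is reached from the OTHER side: ONE RATIONAL Euler-system-side divisibility for E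
at 3 ∥ N (`stub_ub3_ratUpperDivisibility`) + matching Iwasawa invariants μ = 0, λ(X) = λ(L)
(`stub_inv3_invariantsMatch`, to be supplied by Greenberg–Vatsal ∕ EPW transfer from a 3-congruent GOOD ORDINARY
partner E′ — X_E(3) ≅ ℙ¹ — whose BDP main conjecture at p = 3 is REFEREED PRINT: Yan–Zhu 2026 Thm 5.7 (1), tree
fact `YanZhu2026.thm57_isTorsion_charIdealXGr_eq_bdpLFunction`; templates Lei–Müller–Xia 2023 Thm 1, Nguyen
arXiv:2503.00247 Thm A ∕ 7.5 at p ∤ N) ⟹ EQUALITY `Ch.map = (L)` (Washington Prop. 7.2; X1's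
`span_singleton_eq_of_C_pow_mul_mem`) ⟹ the atom. Composition = bdp g17's
`LambdaMatchingAtThree.imcDivTwoLociAtThreeR_of_ratUpperBound_of_invariantsMatch` (p505319).

* `stub_ub3_ratUpperDivisibility` — UB₃ (DECIDING; CONSTRUCTION-grade, standard-method, UNPRINTED at (3, 3 ∥ N):
  Λ-adic Heegner-class Kolyvagin-system bound (Howard 2004 «p ∤ N» ∕ 2007 «p ∤ 6N») + Λ-adic ERL at 3 ∥ N
  (Castella arXiv:2409.01360 Thm 2.2 is p ≥ 5, PRE)): `∃ k, 3^k·L ∈ Ch(X_ac 𝔭bar)·R₀⟦T⟧`.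
* `stub_inv3_invariantsMatch` — INV₃ (size L; print-adjacent: (ε1) YZ26 PRINT, (ε2) two M-sized re-proofs of
  LMX23 ∕ Nguyen at p ∥ N, (ε4) partner supply on the finite-flat sub-locus 3 ∣ v_3(Δ_E) — memo §37.2 ∕ Q37-1..4):
  `∃ g n, Ch(X_ac 𝔭bar) = (g) ∧ FU(map g, n) ∧ FU(L, n)` (FU = first unit coefficient at index n: μ = 0, λ = n).
[cite: Washington1997, Prop. 7.2, §13.2] [cite: EmertonPollackWeston2006, Thm. 1] [cite: YanZhu2026, Thm. 5.7 (1)]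
[cite: LeiMullerXia2023, Thm. 1] [cite: Castella2018, Thm. 2.3, §2.2]
-/

set_option linter.dupNamespace false

noncomputable section

open scoped Classical

open WeierstrassCurve NumberField IsDedekindDomain Field PowerSeries
  Literature.NumberTheory.EllipticCurves Literature.NumberTheory.EllipticCurves.ModularForms
  Literature.NumberTheory.EllipticCurves.Rank1Residual
  Literature.NumberTheory.GaloisRepresentations
  Summit.BirchSwinnertonDyer.Rank1Residual Summit.BirchSwinnertonDyer.Rank1Residual.X11b
  Summit.BirchSwinnertonDyer.Rank1Residual.X11b.AcSelmer
  Summit.BirchSwinnertonDyer.Rank1Residual.X11b.Halves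
  Summit.BirchSwinnertonDyer.Rank1Residual.X11b.Three

namespace Summit.BirchSwinnertonDyer.BirchSwinnertonDyer.Cruxes.IMCDivTwoLociAtThreeR.LambdaMatching

/- the crux `IMCDivTwoLociAtThreeR` is the ROUTE decl
`Summit.BirchSwinnertonDyer.BirchSwinnertonDyer.Theses.ClassRecordThree.IMCDivTwoLociAtThreeR` (imported), concluded BY NAME below. -/

/-- **stub UB₃ — the RATIONAL Euler-system-side divisibility at `3 ∥ N`** (DECIDING): on class X11b@3 with
`ρ̄` onto, off (ram ∧ non-split@3), over S0's datum, every frame `(ι', Ω_K, Ω_p, L)` at `(ι', 𝔭)` and the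
other prime `𝔭bar ∋ 3`: `∃ k, 3^k · L ∈ Ch_Λ(X_ac 𝔭bar)·R₀⟦T⟧`. -/
theorem stub_ub3_ratUpperDivisibility :
    ∀ (W : WeierstrassCurve ℚ) [W.IsElliptic] [W.IsGloballyMinimal],
      ClassX11b W 3 → Surj W 3 → (Ram W 3 → W.HasSplitMultiplicativeReductionAtPrime 3) →
      ∀ (N : ℕ) [NeZero N] (K : Type) [Field K] [NumberField K] (Dt : ModularParametrizationData W N)
      (H : HeegnerDatum N (NumberField.discr K)) (ι : K →+* ℂ) (P : (W.baseChange K).toAffine.Point),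
      ClassX11b W 3 → Surj W 3 → W.conductorNorm ℤ = N → IsImaginaryQuadratic K →
      Odd (NumberField.discr K) → SatisfiesHeegnerHypothesis N K →
      (W.quadraticTwist (NumberField.discr K : ℚ)).entireLFunction 1 ≠ 0 →
      WeierstrassCurve.Affine.Point.map ι.toRatAlgHom P = heegnerPointComplex Dt H →
      ¬ (3 : ℤ) ∣ Dt.c → ¬ IsOfFinAddOrder P →
      ∀ (κ : ZpExtension K 3), κ.IsAnticyclotomic →
        ∀ (γ : Field.absoluteGaloisGroup K) [Fact (κ.IsTopGenerator γ)]
          (𝔭 : HeightOneSpectrum (𝓞 K)), ((3 : ℕ) : 𝓞 K) ∈ 𝔭.asIdeal →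
          𝔭.asIdeal.ramificationIdx (𝓞 ℚ) = 1 → 𝔭.asIdeal.inertiaDeg (𝓞 ℚ) = 1 →
          ∀ (f : CuspForm (CongruenceSubgroup.Gamma0 N) 2), IsNewformOf W f →
            ∀ (ι' : PadicAlgCl 3 ≃+* ℂ), InducesPrime ι' 𝔭 →
              ∀ (ΩK : ℂ) (Ωp : (unrIntegers 3)ˣ) (L : UnrSeries 3), ΩK ≠ 0 →
                IsBDPLFunction ι' 𝔭 κ γ f ΩK ((Ωp : unrIntegers 3) : ℂ_[3]) L →
                  ∀ (𝔭bar : HeightOneSpectrum (𝓞 K)), ((3 : ℕ) : 𝓞 K) ∈ 𝔭bar.asIdeal → 𝔭bar ≠ 𝔭 →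
                    ∃ k : ℕ, C (((3 : ℕ) : unrIntegers 3) ^ k) * L ∈
                      (XAc.charIdeal (W.baseChange K) 3 κ 𝔭bar ∅ γ).map (PowerSeries.map (toUnr 3)) := by
  sorry

/-- **stub INV₃ — matching Iwasawa invariants** (`μ = 0` on both sides, equal `λ`): same binders; a generator
`g` of `Ch_Λ(X_ac 𝔭bar)` and the frame's `L` have their first unit coefficient (read in `R₀`) at the SAME index. -/
theorem stub_inv3_invariantsMatch :
    ∀ (W : WeierstrassCurve ℚ) [W.IsElliptic] [W.IsGloballyMinimal],
      ClassX11b W 3 → Surj W 3 → (Ram W 3 → W.HasSplitMultiplicativeReductionAtPrime 3) →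
      ∀ (N : ℕ) [NeZero N] (K : Type) [Field K] [NumberField K] (Dt : ModularParametrizationData W N)
      (H : HeegnerDatum N (NumberField.discr K)) (ι : K →+* ℂ) (P : (W.baseChange K).toAffine.Point),
      ClassX11b W 3 → Surj W 3 → W.conductorNorm ℤ = N → IsImaginaryQuadratic K →
      Odd (NumberField.discr K) → SatisfiesHeegnerHypothesis N K →
      (W.quadraticTwist (NumberField.discr K : ℚ)).entireLFunction 1 ≠ 0 →
      WeierstrassCurve.Affine.Point.map ι.toRatAlgHom P = heegnerPointComplex Dt H →
      ¬ (3 : ℤ) ∣ Dt.c → ¬ IsOfFinAddOrder P →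
      ∀ (κ : ZpExtension K 3), κ.IsAnticyclotomic →
        ∀ (γ : Field.absoluteGaloisGroup K) [Fact (κ.IsTopGenerator γ)]
          (𝔭 : HeightOneSpectrum (𝓞 K)), ((3 : ℕ) : 𝓞 K) ∈ 𝔭.asIdeal →
          𝔭.asIdeal.ramificationIdx (𝓞 ℚ) = 1 → 𝔭.asIdeal.inertiaDeg (𝓞 ℚ) = 1 →
          ∀ (f : CuspForm (CongruenceSubgroup.Gamma0 N) 2), IsNewformOf W f →
            ∀ (ι' : PadicAlgCl 3 ≃+* ℂ), InducesPrime ι' 𝔭 →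
              ∀ (ΩK : ℂ) (Ωp : (unrIntegers 3)ˣ) (L : UnrSeries 3), ΩK ≠ 0 →
                IsBDPLFunction ι' 𝔭 κ γ f ΩK ((Ωp : unrIntegers 3) : ℂ_[3]) L →
                  ∀ (𝔭bar : HeightOneSpectrum (𝓞 K)), ((3 : ℕ) : 𝓞 K) ∈ 𝔭bar.asIdeal → 𝔭bar ≠ 𝔭 →
                    ∃ (g : IwasawaAlgebra 3) (n : ℕ),
                      XAc.charIdeal (W.baseChange K) 3 κ 𝔭bar ∅ γ = Ideal.span {g} ∧
                      (‖((coeff n (PowerSeries.map (toUnr 3) g) : unrIntegers 3) : ℂ_[3])‖ = 1 ∧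
                        ∀ i < n, ‖((coeff i (PowerSeries.map (toUnr 3) g) : unrIntegers 3) : ℂ_[3])‖ < 1) ∧
                      (‖((coeff n L : unrIntegers 3) : ℂ_[3])‖ = 1 ∧
                        ∀ i < n, ‖((coeff i L : unrIntegers 3) : ℂ_[3])‖ < 1) := by
  sorry

/-! ## Stub statements by name -/

namespace Statement

/-- Statement of `stub_ub3_ratUpperDivisibility`. -/
abbrev stub_ub3_ratUpperDivisibility : Prop := type_of% @LambdaMatching.stub_ub3_ratUpperDivisibility
/-- Statement of `stub_inv3_invariantsMatch`. -/
abbrev stub_inv3_invariantsMatch : Prop := type_of% @LambdaMatching.stub_inv3_invariantsMatch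

end Statement

/-! ## The compositions (sorry-free): the two stub STATEMENTS imply the crux and its KOLY twin, BY NAME -/

/-- **`IMCDivTwoLociAtThreeR_of`** — UB₃ → INV₃ → `IMCDivTwoLociAtThreeR` (bdp g17 p505319:
`LambdaMatchingAtThree.imcDivTwoLociAtThreeR_of_ratUpperBound_of_invariantsMatch`). -/
theorem IMCDivTwoLociAtThreeR_of (hUB : Statement.stub_ub3_ratUpperDivisibility)
    (hINV : Statement.stub_inv3_invariantsMatch) :
    Summit.BirchSwinnertonDyer.BirchSwinnertonDyer.Theses.ClassRecordThree.IMCDivTwoLociAtThreeR :=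
  Summit.BirchSwinnertonDyer.BirchSwinnertonDyer.Theorems.LambdaMatchingAtThree.imcDivTwoLociAtThreeR_of_ratUpperBound_of_invariantsMatch
    hUB hINV

/-- The crux along ROAD B12, MODULO exactly the two registered stubs (sorries live only in `stub_*`). -/
theorem IMCDivTwoLociAtThreeR_proof :
    Summit.BirchSwinnertonDyer.BirchSwinnertonDyer.Theses.ClassRecordThree.IMCDivTwoLociAtThreeR :=
  IMCDivTwoLociAtThreeR_of stub_ub3_ratUpperDivisibility stub_inv3_invariantsMatch

/-- **KOLY twin `IMCDivTwoLociTamAtThreeR_of`** — the same two stubs give item 20263 (KOLY) BY NAME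
(`imcDivTwoLociTamAtThreeR_of_imcDivTwoLociAtThreeR`). -/
theorem IMCDivTwoLociTamAtThreeR_of (hUB : Statement.stub_ub3_ratUpperDivisibility)
    (hINV : Statement.stub_inv3_invariantsMatch) :
    Summit.BirchSwinnertonDyer.BirchSwinnertonDyer.Theses.KolyvaginRoadThree.IMCDivTwoLociTamAtThreeR :=
  Summit.BirchSwinnertonDyer.BirchSwinnertonDyer.Theorems.LambdaMatchingAtThree.imcDivTwoLociTamAtThreeR_of_imcDivTwoLociAtThreeR
    (IMCDivTwoLociAtThreeR_of hUB hINV)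

/-- The KOLY crux along ROAD B12, MODULO exactly the two registered stubs. -/
theorem IMCDivTwoLociTamAtThreeR_proof :
    Summit.BirchSwinnertonDyer.BirchSwinnertonDyer.Theses.KolyvaginRoadThree.IMCDivTwoLociTamAtThreeR :=
  IMCDivTwoLociTamAtThreeR_of stub_ub3_ratUpperDivisibility stub_inv3_invariantsMatch

end Summit.BirchSwinnertonDyer.BirchSwinnertonDyer.Cruxes.IMCDivTwoLociAtThreeR.LambdaMatching

end
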